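import Summits.QuantumFields.BalabanUV.T4Continuum.Support.NE3CovLiftCurl
import Summits.QuantumFields.BalabanUV.T4Continuum.Support.NE3CurlStability
import HarnessLib

/-!
# NE7GaugedCurlGradientNearFlat — supplier stub (S-d′) brick (ROAD-G107 §6 (c′)): ONE LATTICE DERIVATIVE OF THE FLAT CURL OF A GAUGED FIELD AGAINST THE COVARIANT
# CURL-GRADIENT — at a `δ`-flat gauged background (`‖W^{u}(b) − 1‖ ≤ δ`), for `Y` with `‖Y‖ ≤ S`, plain gradient of `Y^{u}` `≤ G′` and `‖curl_W Y‖ ≤ B`: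
# `‖curlAt 1 (Y^{u}) (z+e_λ) − curlAt 1 (Y^{u}) z‖ ≤ ‖Ad_{W(z,λ)}(curl_W Y)(z+e_λ) − (curl_W Y)(z)‖ + 2δB + 16δG′ + 32δS` — the datum `B′` of the flat C¹ letter from (S-b)'s
# COVARIANT curl-gradient of the pair

Cell `pub-balaban`, rung (B)+1 sub-cell t4, lineage `b2b-balaban-t4-ne7-p1`, generation 107 (CRUX PROVER NE7 #1 = OWNER of BINDER row NE7).
Memo `t4/b2b-balaban-t4-ne7-p1-g107/ROAD-G107.md` §6; companion of `NE7GaugedGradientNearFlat` (the same exchange for the field's own gradient).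
MECHANISM.  `curl_V ψ − curl_1 ψ = Σ_{four bonds} ±(Ad_{T_i} − 1)ψ_i` with transports `T_i` = products of ≤ 3 bond variables of `V` (`‖T_i − 1‖ ≤ k_iδ`, `Σk_i = 8`); its adjacent
difference is `Σ ±[(Ad_{T_i′} − 1)(ψ_i′ − ψ_i) + (Ad_{T_i′} − Ad_{T_i})ψ_i]`, `≤ 16δG′ + 32δS`; and the PLAIN difference of `curl_{W^{u}}Y^{u} = Ad_u curl_W Y` (gauge covariance,
`NE3CovLiftCurl.curlAt_gaugeAct`) is the transported one up to `(1 − Ad_{W^{u}(z,λ)})` on a curl, `≤ 2δB`, while the transported one is `Ad_{u(z)}` of the `W`-covariant difference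
(`W^{u}(z,λ)·u(z+e_λ) = u(z)·W(z,λ)`).
WHAT ([folklore]; 0 def, 0 sorry; any dimension, any `n`).  §1 `norm_AdSubOne_fdiff_le`; §2 `curlAt_sub_flat_eq` (the four-term defect), **`norm_fdiff_curlDefect_le`**
(`≤ 16δG′ + 32δs`); §3 `Ad_fdiff_curlAt_gaugeAct` (gauge covariance of the transported curl difference), **`norm_fdiff_curlAt_flat_dirGauge_le`** (headline).
HONEST FRAMING (page 1): gauge-covariance algebra on OUR objects; nothing of Bałaban's asserted; nothing of NE3∕NE7 discharged; spine count = dagwriter∕referees' call; FIXED FINITE T⁴,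
rung (B)+1 — NOT infinite volume, NOT mass gap, NOT BetaPertH, NOT Clay.
-/

set_option autoImplicit false

open scoped BigOperators Matrix.Norms.L2Operator
open NormedSpace

namespace Summit.QuantumFields.BalabanUV.T4Continuum.NE7GaugedCurlGradientNearFlat

open Literature.MathematicalPhysics.QuantumFieldTheory.Balaban1983to89
open B7Prop1Explicit B7Prop2Explicit
open T4AveragingDeficitWall (Ad IsUnitaryCfg curlAt)
open T4AveragingDeficitNonAbelian (Ad_mul Ad_sub)
open AveragingDeficitTransport (norm_Ad_of_unitary)
open AveragingDeficitNearIdentity (Ad_one norm_Ad_sub_le)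
open AveragingDeficitLocality (dirGauge)
open BlockAveragePushDirSplit (flat)
open NE3CovLiftCurl (curlAt_gaugeAct)
open NE3QbarNearFlat (norm_units_inv_sub_one_le')
open NE3NearIdentityGradient (norm_mul_sub_one_le)
open NE3CurlStability (norm_Ad_sub_Ad_le)

noncomputable section

variable {d : ℕ} {n : Type*} [Fintype n] [DecidableEq n]

/-! ## §1 One term of the defect -/

/-- For unitary `T, T′`: `‖(Ad_{T′}ψ′ − ψ′) − (Ad_T ψ − ψ)‖ ≤ 2‖T′ − 1‖·‖ψ′ − ψ‖ + 2(‖T′ − 1‖ + ‖T − 1‖)·‖ψ‖`. [folklore] -/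
theorem norm_AdSubOne_fdiff_le [Nonempty n] {T T' : (Matrix n n ℂ)ˣ} (hT : T ∈ unitaryUnits (Matrix n n ℂ)) (hT' : T' ∈ unitaryUnits (Matrix n n ℂ))
    (ψ ψ' : Matrix n n ℂ) :
    ‖(Ad T' ψ' - ψ') - (Ad T ψ - ψ)‖
      ≤ 2 * ‖(T' : Matrix n n ℂ) - 1‖ * ‖ψ' - ψ‖ + 2 * (‖(T' : Matrix n n ℂ) - 1‖ + ‖(T : Matrix n n ℂ) - 1‖) * ‖ψ‖ := by
  have e1 : (Ad T' ψ' - ψ') - (Ad T ψ - ψ) = (Ad T' (ψ' - ψ) - (ψ' - ψ)) + (Ad T' ψ - Ad T ψ) := by rw [Ad_sub]; abel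
  rw [e1]
  have h1 := norm_Ad_sub_le hT' (ψ' - ψ)
  have h2 := norm_Ad_sub_Ad_le hT hT' ψ
  have h3 : ‖(T' : Matrix n n ℂ) - (T : Matrix n n ℂ)‖ ≤ ‖(T' : Matrix n n ℂ) - 1‖ + ‖(T : Matrix n n ℂ) - 1‖ := by
    calc ‖(T' : Matrix n n ℂ) - (T : Matrix n n ℂ)‖ = ‖((T' : Matrix n n ℂ) - 1) - ((T : Matrix n n ℂ) - 1)‖ := by congr 1; abel
      _ ≤ _ := norm_sub_le _ _
  calc _ ≤ ‖Ad T' (ψ' - ψ) - (ψ' - ψ)‖ + ‖Ad T' ψ - Ad T ψ‖ := norm_add_le _ _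
    _ ≤ 2 * ‖(T' : Matrix n n ℂ) - 1‖ * ‖ψ' - ψ‖ + 2 * ‖(T' : Matrix n n ℂ) - (T : Matrix n n ℂ)‖ * ‖ψ‖ := add_le_add h1 h2
    _ ≤ _ := by
        have := mul_le_mul_of_nonneg_right (mul_le_mul_of_nonneg_left h3 (by norm_num : (0:ℝ) ≤ 2)) (norm_nonneg ψ)
        linarith

/-! ## §2 The curl defect `curl_V − curl_1` and its adjacent differences -/

/-- **THE FOUR-TERM DEFECT**: `curl_V ψ(x;μ,ν) − curl_1 ψ(x;μ,ν) = (Ad_{T₁} − 1)ψ(x,μ) + (Ad_{T₂} − 1)ψ(x+e_μ,ν) − (Ad_{T₂} − 1)ψ(x+e_ν,μ) − (Ad_{T₄} − 1)ψ(x,ν)`,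
`T₁ = V(x,μ)`, `T₂ = V(x,μ)V(x+e_μ,ν)`, `T₄ = T₂·V(x+e_ν,μ)⁻¹`. [folklore] -/
theorem curlAt_sub_flat_eq (V : Site d → Fin d → (Matrix n n ℂ)ˣ) (ψ : Site d → Fin d → Matrix n n ℂ) (x : Site d) (μ ν : Fin d) :
    curlAt V ψ x μ ν - curlAt (flat (d := d) (n := n)) ψ x μ ν
      = (Ad (V x μ) (ψ x μ) - ψ x μ) + (Ad (V x μ * V (x + e μ) ν) (ψ (x + e μ) ν) - ψ (x + e μ) ν)
        - (Ad (V x μ * V (x + e μ) ν) (ψ (x + e ν) μ) - ψ (x + e ν) μ)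
        - (Ad (V x μ * V (x + e μ) ν * (V (x + e ν) μ)⁻¹) (ψ x ν) - ψ x ν) := by
  simp only [curlAt, BlockAveragePushDirSplit.flat, mul_one, inv_one, Ad_one]
  abel

/-- **THE DEFECT IS LIPSCHITZ AT A NEAR-FLAT BACKGROUND**: `V` unitary with `‖V(b) − 1‖ ≤ δ` on every bond, `‖ψ‖ ≤ s`, `‖ψ(y+e_λ,κ) − ψ(y,κ)‖ ≤ G′` ⟹
`‖(curl_V ψ − curl_1 ψ)(x+e_λ;μ,ν) − (curl_V ψ − curl_1 ψ)(x;μ,ν)‖ ≤ 16δG′ + 32δs`. [folklore] -/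
theorem norm_fdiff_curlDefect_le [Nonempty n] {V : Site d → Fin d → (Matrix n n ℂ)ˣ} (hV : IsUnitaryCfg V) (ψ : Site d → Fin d → Matrix n n ℂ)
    {δ s G' : ℝ} (hδ : ∀ (y : Site d) (κ : Fin d), ‖((V y κ : (Matrix n n ℂ)ˣ) : Matrix n n ℂ) - 1‖ ≤ δ) (hs : ∀ y κ, ‖ψ y κ‖ ≤ s)
    (hG : ∀ (y : Site d) (lam κ : Fin d), ‖ψ (y + e lam) κ - ψ y κ‖ ≤ G') (x : Site d) (lam μ ν : Fin d) :
    ‖(curlAt V ψ (x + e lam) μ ν - curlAt (flat (d := d) (n := n)) ψ (x + e lam) μ ν)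
        - (curlAt V ψ x μ ν - curlAt (flat (d := d) (n := n)) ψ x μ ν)‖ ≤ 16 * δ * G' + 32 * δ * s := by
  have hδ0 : 0 ≤ δ := (norm_nonneg _).trans (hδ x μ)
  have hs0 : 0 ≤ s := (norm_nonneg _).trans (hs x μ)
  have hG0 : 0 ≤ G' := (norm_nonneg _).trans (hG x lam μ)
  -- the transports and their distances to `1`
  have hU := fun y κ => hV y κ
  have hT1 : ∀ y, ‖((V y μ : (Matrix n n ℂ)ˣ) : Matrix n n ℂ) - 1‖ ≤ 1 * δ := fun y => by rw [one_mul]; exact hδ y μ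
  have hT2 : ∀ y, ‖((V y μ * V (y + e μ) ν : (Matrix n n ℂ)ˣ) : Matrix n n ℂ) - 1‖ ≤ 2 * δ := fun y => by
    have := norm_mul_sub_one_le (V₁ := V y μ) (hU (y + e μ) ν); linarith [hδ y μ, hδ (y + e μ) ν]
  have hT4 : ∀ y, ‖((V y μ * V (y + e μ) ν * (V (y + e ν) μ)⁻¹ : (Matrix n n ℂ)ˣ) : Matrix n n ℂ) - 1‖ ≤ 3 * δ := fun y => by
    have h3 := norm_units_inv_sub_one_le' (hU (y + e ν) μ)
    have := norm_mul_sub_one_le (V₁ := V y μ * V (y + e μ) ν) ((unitaryUnits _).inv_mem (hU (y + e ν) μ))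
    linarith [hT2 y, hδ (y + e ν) μ]
  have uT1 : ∀ y, V y μ ∈ unitaryUnits (Matrix n n ℂ) := fun y => hU y μ
  have uT2 : ∀ y, V y μ * V (y + e μ) ν ∈ unitaryUnits (Matrix n n ℂ) := fun y => (unitaryUnits _).mul_mem (hU _ _) (hU _ _)
  have uT4 : ∀ y, V y μ * V (y + e μ) ν * (V (y + e ν) μ)⁻¹ ∈ unitaryUnits (Matrix n n ℂ) :=
    fun y => (unitaryUnits _).mul_mem (uT2 y) ((unitaryUnits _).inv_mem (hU _ _))
  -- the generic term bound: transports within `kδ` of `1` ⟹ `≤ 2kδ·G′ + 4kδ·s`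
  have term : ∀ {T T' : (Matrix n n ℂ)ˣ} (_ : T ∈ unitaryUnits (Matrix n n ℂ)) (_ : T' ∈ unitaryUnits (Matrix n n ℂ)) {k : ℝ}
      (_ : ‖(T : Matrix n n ℂ) - 1‖ ≤ k * δ) (_ : ‖(T' : Matrix n n ℂ) - 1‖ ≤ k * δ) (y : Site d) (κ : Fin d),
      ‖(Ad T' (ψ (y + e lam) κ) - ψ (y + e lam) κ) - (Ad T (ψ y κ) - ψ y κ)‖ ≤ 2 * (k * δ) * G' + 4 * (k * δ) * s := by
    intro T T' hT hT' k hk hk' y κ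
    have h := norm_AdSubOne_fdiff_le hT hT' (ψ y κ) (ψ (y + e lam) κ)
    have hk0 : 0 ≤ k * δ := (norm_nonneg _).trans hk
    calc _ ≤ 2 * ‖(T' : Matrix n n ℂ) - 1‖ * ‖ψ (y + e lam) κ - ψ y κ‖ + 2 * (‖(T' : Matrix n n ℂ) - 1‖ + ‖(T : Matrix n n ℂ) - 1‖) * ‖ψ y κ‖ := h
      _ ≤ 2 * (k * δ) * G' + 2 * (k * δ + k * δ) * s :=
          add_le_add (mul_le_mul (mul_le_mul_of_nonneg_left hk' (by norm_num)) (hG y lam κ) (norm_nonneg _) (by positivity))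
            (mul_le_mul (by linarith) (hs y κ) (norm_nonneg _) (by positivity))
      _ = 2 * (k * δ) * G' + 4 * (k * δ) * s := by ring
  -- the four terms (the `ψ`-sites of terms 2, 3 rewritten to the goal's association)
  have t1 := term (uT1 x) (uT1 (x + e lam)) (hT1 x) (hT1 (x + e lam)) x μ
  have t2 := term (uT2 x) (uT2 (x + e lam)) (hT2 x) (hT2 (x + e lam)) (x + e μ) ν
  have t3 := term (uT2 x) (uT2 (x + e lam)) (hT2 x) (hT2 (x + e lam)) (x + e ν) μ
  have t4 := term (uT4 x) (uT4 (x + e lam)) (hT4 x) (hT4 (x + e lam)) x ν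
  rw [show x + e μ + e lam = x + e lam + e μ by abel] at t2
  rw [show x + e ν + e lam = x + e lam + e ν by abel] at t3
  rw [curlAt_sub_flat_eq, curlAt_sub_flat_eq]
  -- regroup as the four term differences
  have eq : ∀ (a1 a2 a3 a4 b1 b2 b3 b4 : Matrix n n ℂ), (a1 + a2 - a3 - a4) - (b1 + b2 - b3 - b4) = (a1 - b1) + (a2 - b2) - (a3 - b3) - (a4 - b4) :=
    fun _ _ _ _ _ _ _ _ => by abel
  have tri : ∀ (c1 c2 c3 c4 : Matrix n n ℂ), ‖c1 + c2 - c3 - c4‖ ≤ ‖c1‖ + ‖c2‖ + ‖c3‖ + ‖c4‖ := fun c1 c2 c3 c4 =>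
    calc ‖c1 + c2 - c3 - c4‖ ≤ ‖c1 + c2 - c3‖ + ‖c4‖ := norm_sub_le _ _
      _ ≤ ‖c1 + c2‖ + ‖c3‖ + ‖c4‖ := by gcongr; exact norm_sub_le _ _
      _ ≤ ‖c1‖ + ‖c2‖ + ‖c3‖ + ‖c4‖ := by gcongr; exact norm_add_le _ _
  rw [eq]
  refine (tri _ _ _ _).trans ?_
  linarith [t1, t2, t3, t4]

/-! ## §3 The flat curl-gradient of the gauged field -/

/-- **GAUGE COVARIANCE OF THE TRANSPORTED CURL DIFFERENCE**:
`Ad_{W^{u}(z,λ)} curl_{W^{u}}(Y^{u})(z+e_λ) − curl_{W^{u}}(Y^{u})(z) = Ad_{u(z)}[Ad_{W(z,λ)} curl_W Y(z+e_λ) − curl_W Y(z)]`. [folklore] -/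
theorem Ad_fdiff_curlAt_gaugeAct (u : Site d → (Matrix n n ℂ)ˣ) (W : Site d → Fin d → (Matrix n n ℂ)ˣ) (Y : Site d → Fin d → Matrix n n ℂ) (z : Site d)
    (lam μ ν : Fin d) :
    Ad (gaugeAct u W z lam) (curlAt (gaugeAct u W) (dirGauge u Y) (z + e lam) μ ν) - curlAt (gaugeAct u W) (dirGauge u Y) z μ ν
      = Ad (u z) (Ad (W z lam) (curlAt W Y (z + e lam) μ ν) - curlAt W Y z μ ν) := by
  rw [curlAt_gaugeAct, curlAt_gaugeAct, ← Ad_mul, Ad_sub, ← Ad_mul]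
  congr 2
  show u z * W z lam * (u (z + e lam))⁻¹ * u (z + e lam) = u z * W z lam
  rw [inv_mul_cancel_right]

/-- **ONE LATTICE DERIVATIVE OF THE FLAT CURL OF THE GAUGED FIELD** (headline): `W, u` unitary, `‖W^{u}(b) − 1‖ ≤ δ` on every bond, `‖Y‖ ≤ S`, plain gradient of `Y^{u}` `≤ G′`,
`‖curl_W Y (z+e_λ;μ,ν)‖ ≤ B` ⟹
`‖curl_1(Y^{u})(z+e_λ;μ,ν) − curl_1(Y^{u})(z;μ,ν)‖ ≤ ‖Ad_{W(z,λ)} curl_W Y(z+e_λ;μ,ν) − curl_W Y(z;μ,ν)‖ + 2δB + 16δG′ + 32δS`. [folklore] -/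
theorem norm_fdiff_curlAt_flat_dirGauge_le [Nonempty n] {W : Site d → Fin d → (Matrix n n ℂ)ˣ} (hW : IsUnitaryCfg W) {u : Site d → (Matrix n n ℂ)ˣ}
    (hu : ∀ y, u y ∈ unitaryUnits (Matrix n n ℂ)) (Y : Site d → Fin d → Matrix n n ℂ) {δ S G' B : ℝ}
    (hδ : ∀ (y : Site d) (κ : Fin d), ‖((gaugeAct u W y κ : (Matrix n n ℂ)ˣ) : Matrix n n ℂ) - 1‖ ≤ δ) (hS : ∀ y κ, ‖Y y κ‖ ≤ S)
    (hG' : ∀ (y : Site d) (lam κ : Fin d), ‖dirGauge u Y (y + e lam) κ - dirGauge u Y y κ‖ ≤ G') (z : Site d) (lam μ ν : Fin d)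
    (hB : ‖curlAt W Y (z + e lam) μ ν‖ ≤ B) :
    ‖curlAt (flat (d := d) (n := n)) (dirGauge u Y) (z + e lam) μ ν - curlAt (flat (d := d) (n := n)) (dirGauge u Y) z μ ν‖
      ≤ ‖Ad (W z lam) (curlAt W Y (z + e lam) μ ν) - curlAt W Y z μ ν‖ + 2 * δ * B + 16 * δ * G' + 32 * δ * S := by
  set V := gaugeAct u W with hV
  set ψ := dirGauge u Y with hψ
  have hVu : IsUnitaryCfg V := fun y κ =>
    (unitaryUnits _).mul_mem ((unitaryUnits _).mul_mem (hu _) (hW _ _)) ((unitaryUnits _).inv_mem (hu _))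
  have hψS : ∀ y κ, ‖ψ y κ‖ ≤ S := fun y κ => by rw [hψ, show dirGauge u Y y κ = Ad (u (y + e κ)) (Y y κ) from rfl, norm_Ad_of_unitary (hu _)]; exact hS y κ
  -- split: flat difference = curved PLAIN difference − defect difference
  set c' := curlAt V ψ (z + e lam) μ ν with hc'
  set c := curlAt V ψ z μ ν with hc
  set f' := curlAt (flat (d := d) (n := n)) ψ (z + e lam) μ ν with hf'
  set f := curlAt (flat (d := d) (n := n)) ψ z μ ν with hf
  have hdef := norm_fdiff_curlDefect_le hVu ψ hδ hψS hG' z lam μ ν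
  -- the curved plain difference against the transported one, and gauge covariance
  have hcov : Ad (V z lam) c' - c = Ad (u z) (Ad (W z lam) (curlAt W Y (z + e lam) μ ν) - curlAt W Y z μ ν) := Ad_fdiff_curlAt_gaugeAct u W Y z lam μ ν
  have hc'B : ‖c'‖ ≤ B := by rw [hc', hV, hψ, curlAt_gaugeAct, norm_Ad_of_unitary (hu _)]; exact hB
  have hplain : ‖c' - c‖ ≤ ‖Ad (W z lam) (curlAt W Y (z + e lam) μ ν) - curlAt W Y z μ ν‖ + 2 * δ * B := by
    have e1 : c' - c = (Ad (V z lam) c' - c) - (Ad (V z lam) c' - c') := by abel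
    rw [e1]
    calc _ ≤ ‖Ad (V z lam) c' - c‖ + ‖Ad (V z lam) c' - c'‖ := norm_sub_le _ _
      _ ≤ ‖Ad (W z lam) (curlAt W Y (z + e lam) μ ν) - curlAt W Y z μ ν‖ + 2 * δ * B := by
          rw [hcov, norm_Ad_of_unitary (hu z)]
          refine add_le_add le_rfl ((norm_Ad_sub_le (hVu z lam) c').trans ?_)
          exact mul_le_mul (mul_le_mul_of_nonneg_left (hδ z lam) (by norm_num)) hc'B (norm_nonneg _) (by linarith [(norm_nonneg _).trans (hδ z lam)])
  -- assemble: `f′ − f = (c′ − c) − ((c′ − f′) − (c − f))`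
  have e2 : f' - f = (c' - c) - ((c' - f') - (c - f)) := by abel
  rw [e2]
  calc _ ≤ ‖c' - c‖ + ‖(c' - f') - (c - f)‖ := norm_sub_le _ _
    _ ≤ (‖Ad (W z lam) (curlAt W Y (z + e lam) μ ν) - curlAt W Y z μ ν‖ + 2 * δ * B) + (16 * δ * G' + 32 * δ * S) := add_le_add hplain hdef
    _ = _ := by ring

end

end Summit.QuantumFields.BalabanUV.T4Continuum.NE7GaugedCurlGradientNearFlat
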